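import Summits.AtomisticToContinuum.FouriersLaw.Theorems.VanishingNoiseTransferNoisyFourierOfResistanceGluing

/-!
# `NoisyFourier` from the finite-volume Green–Kubo limit of the flip chain (line `sector-dirichlet-gluing`, c3)

Crux `VanishingNoiseTransfer.NoisyFourier` (stmt-AtomisticToContinuum-11977). The cleanest form of the open core:
NO steady states, NO `δ`-limits, NO families. For the pinned anharmonic chain at EQUILIBRIUM temperature `T`
with flips at rate `ε`, a classical forward field of the left bath is `g_L ∈ C² ∩ L²(μ_T)` with
`(L_{T,T} + εS) g_L = −(p_0² − T)` pointwise; it EXISTS (the dual forward fields `FF''(ε)` of the sister crux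
`VanishingNoiseBound`, `FlipPositiveConductance.dualForwardFields_of_mild_hypo_upgrade_cont` with the four landed
stubs) and is UNIQUE up to an additive constant (`VanishingNoiseBound.flip_forwardField_unique`), so the
finite-volume Kubo conductance `G_L(ε,T) = γ(1 − (γ/T²)⟨g_L, p_0² − T⟩_{μ_T})` is canonical, and by the landed
Kubo link (`VanishingNoiseBound.flip_kuboLink_of_dualForwardFields`) it IS the response per bond:
`D_L = (L − 1)·G_L` along the unique flip-steady family.

* `responseLimit_of_dualForwardFields_of_kuboLimit` — if for all parameters, `T > 0`, `ε > 0` there is `κ > 0`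
  such that `(L−1)·G_L → κ` for EVERY family of classical forward fields (equivalently for one, by uniqueness up to
  constants and `μ_T(p_0² − T) = 0`), then along every flip-steady family the responses converge to a positive
  limit (the hypothesis of `noisyFourier_of_responseLimit`, `…OfResponseLimit.lean`).
* `noisyFourier_of_kuboLimit` — **hence the crux.** This is the statement to attack / promote: the `L → ∞` limit of
  the open-chain Green–Kubo conductivity `(L−1)G_L(ε,T)` of the velocity-flip anharmonic chain exists and is
  positive (Bernardin–Olla 2011 prove the infinite-volume Green–Kubo limit WITH flips, Thm 2, and the NESS law only
  for the harmonic bulk, Thm 3; the finite-volume/boundary-driven anharmonic statement is not in print, p. 3).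

No definitions; no sorry; both theorems are implications.
-/

noncomputable section

namespace Summit.AtomisticToContinuum.FouriersLaw.Theorems.NoisyFourier.LineAssembly

open Filter Topology MeasureTheory
open Literature.MathematicalPhysics.KineticTheory.HeatConduction
open Summit.AtomisticToContinuum.FouriersLaw.Cruxes.NoisyFourier
open Summit.AtomisticToContinuum.FouriersLaw.Theorems
open Summit.AtomisticToContinuum.FouriersLaw.Theorems.SuperadditiveResistance.DeviceLiouville (kin)
open Summit.AtomisticToContinuum.FouriersLaw.Cruxes.ConductanceLowerBound.ForecastSensitivity (memLp_two_of_abs_le_exp)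

/-- **Response limit from the Green–Kubo limit.** Given the dual forward fields `FF''(ε)` (hypothesis `hFF`, the
derivative-free package of `FlipPositiveConductance.dualForwardFields_of_mild_hypo_upgrade_cont`, discharged below)
and the Kubo-limit hypothesis `hκ` (for all parameters, `T, ε > 0`: `∃ κ > 0` with `(L−1)·γ(1 − (γ/T²)⟨g L, p_0² − T⟩) → κ`
for every family `g` of classical `C² ∩ L²(μ_T)` forward fields), the response coefficients along every flip-steady
family converge to a positive limit: per `L ≥ 2` the Kubo link identifies `D_L` with `(L−1)·G_L` computed from the
equilibrium member `g 0` of the dual field package, and `hκ` is applied to that family (junk `0` below `L = 2`). -/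
theorem responseLimit_of_dualForwardFields_of_kuboLimit
    (hFF : ∀ (ω₂ lam β γ T ε : ℝ), 0 < ω₂ → 0 < lam → 0 < β → 0 < γ → 0 < T → 0 < ε → ∀ μ : (N : ℕ) → ℝ → ℝ → MeasureTheory.Measure (Literature.MathematicalPhysics.KineticTheory.HeatConduction.PhaseSpace N), (∀ (N : ℕ) (T_L T_R : ℝ), 0 < T_L → 0 < T_R → (Literature.MathematicalPhysics.KineticTheory.HeatConduction.pinnedChain ω₂ lam β γ).IsFlipSteadyState N T_L T_R ε (μ N T_L T_R) ∧ ∀ ν : MeasureTheory.Measure (Literature.MathematicalPhysics.KineticTheory.HeatConduction.PhaseSpace N), (Literature.MathematicalPhysics.KineticTheory.HeatConduction.pinnedChain ω₂ lam β γ).IsFlipSteadyState N T_L T_R ε ν → ν = μ N T_L T_R) → ∀ (L : ℕ) (hL : 2 ≤ L), ∃ (g : ℝ → Literature.MathematicalPhysics.KineticTheory.HeatConduction.PhaseSpace L → ℝ) (δ₀ : ℝ), 0 < δ₀ ∧ ContDiff ℝ 2 (g 0) ∧ (∀ x, (Literature.MathematicalPhysics.KineticTheory.HeatConduction.pinnedChain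 ω₂ lam β γ).flipGenerator L T T ε (g 0) x = -(Summit.AtomisticToContinuum.FouriersLaw.Theorems.SuperadditiveResistance.DeviceLiouville.kin L 0 x - T)) ∧ (∀ δ, |δ| < δ₀ → ∃ C : ℝ, ∀ x, |g δ x| ≤ C * Real.exp (1 / (4 * T) * (Literature.MathematicalPhysics.KineticTheory.HeatConduction.pinnedChain ω₂ lam β γ).hamiltonian L x)) ∧ (∀ δ, 0 < |δ| → |δ| < δ₀ → Measurable (g δ) ∧ ∀ φ : Literature.MathematicalPhysics.KineticTheory.HeatConduction.PhaseSpace L → ℝ, ContDiff ℝ ((⊤ : ℕ∞) : WithTop ℕ∞) φ → HasCompactSupport φ → ∫ x, g δ x * (-((Literature.MathematicalPhysics.KineticTheory.HeatConduction.pinnedChain ω₂ lam β γ).generator L (T + δ / 2) (T - δ / 2) φ x) + 2 * γ * ((T + δ / 2) * Literature.MathematicalPhysics.KineticTheory.HeatConduction.partialP (⟨0, by omega⟩ : Fin L) (Literature.MathematicalPhysics.KineticTheory.HeatConduction.partialP (⟨0, by omega⟩ : Fin L) φ) x + (T - δ / 2) * Literature.MathematicalPhysics.KineticTheory.HeatConduction.partialP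 (⟨L - 1, by omega⟩ : Fin L) (Literature.MathematicalPhysics.KineticTheory.HeatConduction.partialP (⟨L - 1, by omega⟩ : Fin L) φ) x) + 2 * γ * φ x + ε * Literature.MathematicalPhysics.KineticTheory.HeatConduction.flipNoise L φ x) = ∫ x, (-(Summit.AtomisticToContinuum.FouriersLaw.Theorems.SuperadditiveResistance.DeviceLiouville.kin L 0 x - T) + ∫ y, (Summit.AtomisticToContinuum.FouriersLaw.Theorems.SuperadditiveResistance.DeviceLiouville.kin L 0 y - T) ∂(μ L (T + δ / 2) (T - δ / 2))) * φ x) ∧ Filter.Tendsto (fun δ => ∫ x, g δ x * (Summit.AtomisticToContinuum.FouriersLaw.Theorems.SuperadditiveResistance.DeviceLiouville.kin L 0 x - T) ∂((Literature.MathematicalPhysics.KineticTheory.HeatConduction.pinnedChain ω₂ lam β γ).gibbsMeasure L T)) (nhdsWithin 0 {(0 : ℝ)}ᶜ) (nhds (∫ x, g 0 x * (Summit.AtomisticToContinuum.FouriersLaw.Theorems.SuperadditiveResistance.DeviceLiouville.kin L 0 x - T) ∂((Literature.MathematicalPhysics.KineticTheory.HeatConduction.pinnedChain ω₂ lam β γ).gibbsMeasure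 L T))) ∧ Filter.Tendsto (fun δ => ∫ x, g δ x * (Summit.AtomisticToContinuum.FouriersLaw.Theorems.SuperadditiveResistance.DeviceLiouville.kin L (L - 1) x - T) ∂((Literature.MathematicalPhysics.KineticTheory.HeatConduction.pinnedChain ω₂ lam β γ).gibbsMeasure L T)) (nhdsWithin 0 {(0 : ℝ)}ᶜ) (nhds (∫ x, g 0 x * (Summit.AtomisticToContinuum.FouriersLaw.Theorems.SuperadditiveResistance.DeviceLiouville.kin L (L - 1) x - T) ∂((Literature.MathematicalPhysics.KineticTheory.HeatConduction.pinnedChain ω₂ lam β γ).gibbsMeasure L T))))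
    (hκ : ∀ (ω₂ lam β γ T ε : ℝ), 0 < ω₂ → 0 < lam → 0 < β → 0 < γ → 0 < T → 0 < ε → ∃ κ : ℝ, 0 < κ ∧ ∀ g : (L : ℕ) → Literature.MathematicalPhysics.KineticTheory.HeatConduction.PhaseSpace L → ℝ, (∀ L : ℕ, 2 ≤ L → ContDiff ℝ 2 (g L) ∧ MeasureTheory.MemLp (g L) 2 ((Literature.MathematicalPhysics.KineticTheory.HeatConduction.pinnedChain ω₂ lam β γ).gibbsMeasure L T) ∧ ∀ x, (Literature.MathematicalPhysics.KineticTheory.HeatConduction.pinnedChain ω₂ lam β γ).flipGenerator L T T ε (g L) x = -(Summit.AtomisticToContinuum.FouriersLaw.Theorems.SuperadditiveResistance.DeviceLiouville.kin L 0 x - T)) → Filter.Tendsto (fun L : ℕ => ((L : ℝ) - 1) * (γ * (1 - γ / T ^ 2 * MeasureTheory.integral ((Literature.MathematicalPhysics.KineticTheory.HeatConduction.pinnedChain ω₂ lam β γ).gibbsMeasure L T) (fun x => g L x * (Summit.AtomisticToContinuum.FouriersLaw.Theorems.SuperadditiveResistance.DeviceLiouville.kin L 0 x - T))))) Filter.atTop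 (nhds κ)) :
    (∀ ω₂ lam β γ : ℝ, 0 < ω₂ → 0 < lam → 0 < β → 0 < γ → ∀ ε : ℝ, 0 < ε →
      (∀ (N : ℕ) (T_L T_R : ℝ), 0 < T_L → 0 < T_R →
        ∀ μ ν : MeasureTheory.Measure
            (Literature.MathematicalPhysics.KineticTheory.HeatConduction.PhaseSpace N),
          (Literature.MathematicalPhysics.KineticTheory.HeatConduction.pinnedChain
              ω₂ lam β γ).IsFlipSteadyState N T_L T_R ε μ →
          (Literature.MathematicalPhysics.KineticTheory.HeatConduction.pinnedChain
              ω₂ lam β γ).IsFlipSteadyState N T_L T_R ε ν → μ = ν) →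
      ∀ μ : (N : ℕ) → ℝ → ℝ → MeasureTheory.Measure
          (Literature.MathematicalPhysics.KineticTheory.HeatConduction.PhaseSpace N),
        (∀ (N : ℕ) (T_L T_R : ℝ), 0 < T_L → 0 < T_R →
          (Literature.MathematicalPhysics.KineticTheory.HeatConduction.pinnedChain
              ω₂ lam β γ).IsFlipSteadyState N T_L T_R ε (μ N T_L T_R)) →
        ∀ T : ℝ, 0 < T → ∀ D : ℕ → ℝ,
          (∀ N : ℕ, Filter.Tendsto (fun δ : ℝ =>
            (Literature.MathematicalPhysics.KineticTheory.HeatConduction.pinnedChain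
                ω₂ lam β γ).totalCurrent (μ N (T + δ / 2) (T - δ / 2)) / δ)
            (nhdsWithin 0 {(0 : ℝ)}ᶜ) (nhds (D N))) →
          ∃ s : ℝ, 0 < s ∧ Filter.Tendsto D Filter.atTop (nhds s)) := by
  intro ω₂ lam β γ hω hl hβ hγ ε hε huniq μ hμ T hT D hD
  obtain ⟨κ, hκ0, hκlim⟩ := hκ ω₂ lam β γ T ε hω hl hβ hγ hT hε
  have hμ' : ∀ (N : ℕ) (T_L T_R : ℝ), 0 < T_L → 0 < T_R →
      (pinnedChain ω₂ lam β γ).IsFlipSteadyState N T_L T_R ε (μ N T_L T_R) ∧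
        ∀ ν : Measure (PhaseSpace N),
          (pinnedChain ω₂ lam β γ).IsFlipSteadyState N T_L T_R ε ν → ν = μ N T_L T_R :=
    fun N T_L T_R hL hR =>
      ⟨hμ N T_L T_R hL hR, fun ν hν => huniq N T_L T_R hL hR ν (μ N T_L T_R) hν (hμ N T_L T_R hL hR)⟩
  have h14' : 2 * (1 / (4 * T)) < 1 / T := by
    rw [show 2 * (1 / (4 * T)) = 1 / (2 * T) by field_simp; ring, div_lt_div_iff₀ (by positivity) hT]
    nlinarith
  -- per `N ≥ 2`: a classical forward field with the Kubo link
  have key : ∀ N : ℕ, 2 ≤ N → ∃ g0 : PhaseSpace N → ℝ, ContDiff ℝ 2 g0 ∧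
      MemLp g0 2 ((pinnedChain ω₂ lam β γ).gibbsMeasure N T) ∧
      (∀ x, (pinnedChain ω₂ lam β γ).flipGenerator N T T ε g0 x = -(kin N 0 x - T)) ∧
      D N = ((N : ℝ) - 1) * (γ * (1 - γ / T ^ 2 *
        ∫ x, g0 x * (kin N 0 x - T) ∂((pinnedChain ω₂ lam β γ).gibbsMeasure N T))) := by
    intro N hN
    obtain ⟨g, δ₀, hδ₀, hC, hpde, hbd, hweak, hlim0, hlim1⟩ :=
      hFF ω₂ lam β γ T ε hω hl hβ hγ hT hε μ hμ' N hN
    obtain ⟨C₀, hgb0⟩ := hbd 0 (by simpa using hδ₀)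
    have hlink := VanishingNoiseBound.flip_kuboLink_of_dualForwardFields μ D hω hl hβ hγ hT hε hμ' hN (hD N)
      g hδ₀ (fun δ h0 h1 => ((hweak δ h0 h1).1).aestronglyMeasurable) (fun δ _ h1 => hbd δ h1)
      (fun δ h0 h1 => (hweak δ h0 h1).2) hlim0 hlim1 hC hgb0 hpde
    have hgL2 : MemLp (g 0) 2 ((pinnedChain ω₂ lam β γ).gibbsMeasure N T) :=
      memLp_two_of_abs_le_exp hω hl.le hβ.le γ N hT h14' hC.continuous hgb0
    have hN1 : 0 < (N : ℝ) - 1 := by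
      have : (2 : ℝ) ≤ (N : ℝ) := by exact_mod_cast hN
      linarith
    refine ⟨g 0, hC, hgL2, hpde, ?_⟩
    rw [← hlink]
    field_simp
  classical
  let gfam : (L : ℕ) → PhaseSpace L → ℝ := fun L =>
    if h : 2 ≤ L then Classical.choose (key L h) else fun _ => 0
  have hgfam : ∀ L : ℕ, 2 ≤ L → ContDiff ℝ 2 (gfam L) ∧
      MemLp (gfam L) 2 ((pinnedChain ω₂ lam β γ).gibbsMeasure L T) ∧
      ∀ x, (pinnedChain ω₂ lam β γ).flipGenerator L T T ε (gfam L) x = -(kin L 0 x - T) := by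
    intro L hL
    have hspec := Classical.choose_spec (key L hL)
    simp only [gfam, dif_pos hL]
    exact ⟨hspec.1, hspec.2.1, hspec.2.2.1⟩
  have hDL : ∀ L : ℕ, 2 ≤ L → D L = ((L : ℝ) - 1) * (γ * (1 - γ / T ^ 2 *
      ∫ x, gfam L x * (kin L 0 x - T) ∂((pinnedChain ω₂ lam β γ).gibbsMeasure L T))) := by
    intro L hL
    have hspec := Classical.choose_spec (key L hL)
    simp only [gfam, dif_pos hL]
    exact hspec.2.2.2
  have hlim := hκlim gfam hgfam
  refine ⟨κ, hκ0, ?_⟩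
  refine hlim.congr' ?_
  filter_upwards [eventually_ge_atTop 2] with L hL
  exact (hDL L hL).symm

/-- **`NoisyFourier` from the finite-volume Green–Kubo limit of the flip chain.** If for all `ω₂, lam, β, γ, T, ε > 0`
there is `κ > 0` such that `(L − 1)·γ(1 − (γ/T²) ∫ g_L·(p_0² − T) dμ_T) → κ` as `L → ∞` for every family
`(g_L)_{L ≥ 2}` of classical forward fields (`g_L ∈ C² ∩ L²(μ_T)`, `(L_{T,T} + εS) g_L = −(p_0² − T)`; they exist
and are unique up to constants, so "every" = "the"), then the crux `VanishingNoiseTransfer.NoisyFourier` holds: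
the dual forward fields are supplied by the four landed `VanishingNoiseBound` stubs, the response limit by
`responseLimit_of_dualForwardFields_of_kuboLimit`, clause (i) and the fixed-`L` response by the landed stubs of the
line, and clause (ii) for every family by `flipFouriersLawFor_of_canonical` (same assembly as
`noisyFourier_of_responseLimit`, inlined so that this file depends only on built modules). -/
theorem noisyFourier_of_kuboLimit : (∀ (ω₂ lam β γ T ε : ℝ), 0 < ω₂ → 0 < lam → 0 < β → 0 < γ → 0 < T → 0 < ε → ∃ κ : ℝ, 0 < κ ∧ ∀ g : (L : ℕ) → Literature.MathematicalPhysics.KineticTheory.HeatConduction.PhaseSpace L → ℝ, (∀ L : ℕ, 2 ≤ L → ContDiff ℝ 2 (g L) ∧ MeasureTheory.MemLp (g L) 2 ((Literature.MathematicalPhysics.KineticTheory.HeatConduction.pinnedChain ω₂ lam β γ).gibbsMeasure L T) ∧ ∀ x, (Literature.MathematicalPhysics.KineticTheory.HeatConduction.pinnedChain ω₂ lam β γ).flipGenerator L T T ε (g L) x = -(Summit.AtomisticToContinuum.FouriersLaw.Theorems.SuperadditiveResistance.DeviceLiouville.kin L 0 x - T)) → Filter.Tendsto (fun L : ℕ =>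 ((L : ℝ) - 1) * (γ * (1 - γ / T ^ 2 * MeasureTheory.integral ((Literature.MathematicalPhysics.KineticTheory.HeatConduction.pinnedChain ω₂ lam β γ).gibbsMeasure L T) (fun x => g L x * (Summit.AtomisticToContinuum.FouriersLaw.Theorems.SuperadditiveResistance.DeviceLiouville.kin L 0 x - T))))) Filter.atTop (nhds κ)) → Summit.AtomisticToContinuum.FouriersLaw.Theses.VanishingNoiseTransfer.NoisyFourier :=
  fun hκ =>
  noisyFourier_iff_flipFouriersLawFor.2 fun ω₂ lam β γ hω hl hβ hγ ε hε => by
    have hEU := existsUnique_of_exists_of_unique SectorDirichletGluing.stub_flipNessExists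
      SectorDirichletGluing.flipNessUnique ω₂ lam β γ hω hl hβ hγ ε hε
    refine flipFouriersLawFor_of_canonical (pinnedChain ω₂ lam β γ) ε hEU fun μ hμ T hT => ?_
    have huniq := uniq_of_existsUnique hEU
    have hDex := SectorDirichletGluing.stub_flipFiniteResponse ω₂ lam β γ hω hl hβ hγ ε hε huniq μ hμ T hT
    choose D hD using hDex
    obtain ⟨s, hs0, hDs⟩ :=
      responseLimit_of_dualForwardFields_of_kuboLimit
        (NoisyFourier.FlipPositiveConductance.dualForwardFields_of_mild_hypo_upgrade_cont
          VanishingNoiseBound.stub_flipMildDistributional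
          VanishingNoiseBound.stub_flipHypoelliptic
          VanishingNoiseBound.stub_flipSmoothMildUpgrade
          VanishingNoiseBound.stub_flipMildContinuity)
        hκ ω₂ lam β γ hω hl hβ hγ ε hε huniq μ hμ T hT D hD
    exact ⟨s, hs0, D, hD, hDs⟩

end Summit.AtomisticToContinuum.FouriersLaw.Theorems.NoisyFourier.LineAssembly

end
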